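import Mathlib

/-!
# Squared-activation sampling: dimension-free pooling perturbation, Frobenius-free domination
# of a dense layer acting on a squared unit vector, and the rejection envelope of a residual
# sparse layer (DEQ-A74)

HONEST FRAMING: instance-level adjudication of specific advantage claims; no claim about
BQP vs BPP or the summit.

Context (cell pub-qadeq, claim A-74 = Rattew, Huang, Guo, Pira, Rebentrost, "Accelerating inference
for multilayer neural networks with quantum computers", arXiv:2510.07195v2, published at ICLR 2026:
Definition 1, Lemma 6, Lemma 7, Theorem 2, Lemma C.1, Lemma C.2, App. E.1).  DEQ-A74.md (unit
pub-qadeq-deq-1) gives a classical sample-and-query algorithm ("Algorithm RS") for the paper's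
Regime-1 architecture (`k` residual 3×3-convolution blocks with `erf` activations and normalisation,
then the "full-rank linear pooling" output block `γ = τψ + (1-τ) W (ψ∘ψ)`, `y_c = Σ_{l∈B_c} γ_l²/‖γ‖²`)
whose cost is `O(log N)` in the dimension and polynomial in `1/ε`.  The probabilistic parts
(rejection sampling, Bernstein, median of means) are NOT formalised here; this file proves,
sorry-free, the finite inequalities that carry the construction:

* `pool_perturb_sq`, `pool_perturb_of_sq_sum_le_one`: for ANY binning map `bin : ι → κ`,
  `Σ_c (Σ_{bin l = c} (a_l² − b_l²))² ≤ (Σ_l (a_l − b_l)²) · (Σ_l (a_l + b_l)²) ≤ 4 Σ_l (a_l − b_l)²`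
  when `Σ a² ≤ 1`, `Σ b² ≤ 1` — the dimension-free replacement of the paper's Lemma C.1
  (which states the bound `(2Nε/√C)²`); with a classical cost polynomial in the inverse accuracy
  this sharpening is what keeps the dimension `N` out of the classical complexity;
* `mean_sq_le_mean_of_sq`: for a probability vector `p` and any reals `w_j`,
  `(Σ_j p_j w_j)² ≤ Σ_j p_j w_j²` — applied with `p = ψ∘ψ` and `w_j = W_{lj}` it bounds
  `(W(ψ∘ψ))_l²` by the law of "`j ∼ p`, then `l ∼` column `j` of `W`" with an importance weight
  at most `max_j ‖W_{·j}‖² ≤ ‖W‖₂² ≤ 1`: no Frobenius norm, no rank, no sparsity of `W` enters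
  (this is the step App. E.1 of the paper believes to obstruct dequantization);
* `sq_sub_sq_sum_le`: `Σ_l (u_l² − x_l²)² ≤ M · Σ_l (u_l − x_l)²` when `(u_l + x_l)² ≤ M` —
  the Lipschitz estimate for the entrywise square `g(ψ) = ψ∘ψ` on bounded vectors;
* `mul_sq_add_le`, `residual_envelope`: `g (x+e)² ≤ g(1+g) x² + (1+g) e²` (any real `g`), and the
  rejection-sampling envelope of one residual sparse layer: if `s e² ≤ g² S` (in the algorithm
  `e = erf(0.8 (W x)_J)`, `S = Σ_{J'∈RF(J)} x_{J'}²`, `s` the fan-out and `g = Lρ√s`), then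
  `s (x + e)² ≤ (1+g) (s x² + g S)`, i.e. the target `(x_J + e_J)²` is dominated by `(1+g)²` times
  the mixture proposal `x_J²/(1+g) + (g/(1+g)) S_J/s` (DEQ-A74 Lemma E).

Everything is `[folklore]`-level finite algebra / real arithmetic; no named fact, no axiom, no `def`.
-/

namespace Literature.Computability.QuantumAlgorithms.SquaredActivationSampling

open Finset BigOperators

section Pooling

variable {ι κ : Type*} [Fintype ι] [Fintype κ] [DecidableEq κ]

omit [DecidableEq κ] in
/-- `[folklore]` auxiliary: for nonnegative `X, Y : κ → ℝ`, `Σ_c X_c Y_c ≤ (Σ_c X_c)(Σ_c Y_c)`. -/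
theorem sum_mul_le_sum_mul_sum (X Y : κ → ℝ) (hX : ∀ c, 0 ≤ X c) (hY : ∀ c, 0 ≤ Y c) :
    ∑ c, X c * Y c ≤ (∑ c, X c) * ∑ c, Y c := by
  rw [Finset.sum_mul]
  refine Finset.sum_le_sum fun c _ => ?_
  exact mul_le_mul_of_nonneg_left
    (Finset.single_le_sum (fun d _ => hY d) (Finset.mem_univ c)) (hX c)

/-- `[folklore]` **Dimension-free pooling perturbation** (replaces arXiv:2510.07195 Lemma C.1).
For any binning `bin : ι → κ` and real vectors `a, b`,
`Σ_c (Σ_{l : bin l = c} (a_l² − b_l²))² ≤ (Σ_l (a_l − b_l)²) · (Σ_l (a_l + b_l)²)`.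
Proof: Cauchy–Schwarz inside each bin, then `Σ_c X_c Y_c ≤ (Σ X)(Σ Y)` and re-assembly of the
fibre sums. -/
theorem pool_perturb_sq (bin : ι → κ) (a b : ι → ℝ) :
    ∑ c, (∑ l ∈ univ.filter (fun l => bin l = c), (a l ^ 2 - b l ^ 2)) ^ 2
      ≤ (∑ l, (a l - b l) ^ 2) * ∑ l, (a l + b l) ^ 2 := by
  classical
  -- per-bin Cauchy–Schwarz
  have hbin : ∀ c, (∑ l ∈ univ.filter (fun l => bin l = c), (a l ^ 2 - b l ^ 2)) ^ 2
      ≤ (∑ l ∈ univ.filter (fun l => bin l = c), (a l - b l) ^ 2)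
        * ∑ l ∈ univ.filter (fun l => bin l = c), (a l + b l) ^ 2 := by
    intro c
    have h := Finset.sum_mul_sq_le_sq_mul_sq (univ.filter (fun l => bin l = c))
      (fun l => a l - b l) (fun l => a l + b l)
    have heq : ∑ l ∈ univ.filter (fun l => bin l = c), (a l ^ 2 - b l ^ 2)
        = ∑ l ∈ univ.filter (fun l => bin l = c), (a l - b l) * (a l + b l) := by
      refine Finset.sum_congr rfl fun l _ => ?_
      ring
    rw [heq]
    exact h
  calc ∑ c, (∑ l ∈ univ.filter (fun l => bin l = c), (a l ^ 2 - b l ^ 2)) ^ 2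
      ≤ ∑ c, (∑ l ∈ univ.filter (fun l => bin l = c), (a l - b l) ^ 2)
          * ∑ l ∈ univ.filter (fun l => bin l = c), (a l + b l) ^ 2 :=
        Finset.sum_le_sum fun c _ => hbin c
    _ ≤ (∑ c, ∑ l ∈ univ.filter (fun l => bin l = c), (a l - b l) ^ 2)
          * ∑ c, ∑ l ∈ univ.filter (fun l => bin l = c), (a l + b l) ^ 2 :=
        sum_mul_le_sum_mul_sum _ _ (fun c => Finset.sum_nonneg fun l _ => sq_nonneg _)
          (fun c => Finset.sum_nonneg fun l _ => sq_nonneg _)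
    _ = (∑ l, (a l - b l) ^ 2) * ∑ l, (a l + b l) ^ 2 := by
        rw [Finset.sum_fiberwise univ bin (fun l => (a l - b l) ^ 2),
          Finset.sum_fiberwise univ bin (fun l => (a l + b l) ^ 2)]

/-- `[folklore]` Corollary used in DEQ-A74 (Lemma P): for vectors of squared norm at most one,
`‖pool(a) − pool(b)‖₂² ≤ 4 ‖a − b‖₂²`, uniformly in the dimension and in the number of bins
(arXiv:2510.07195 Lemma C.1 has `4N²ε²/C` on the right). -/
theorem pool_perturb_of_sq_sum_le_one (bin : ι → κ) (a b : ι → ℝ)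
    (ha : ∑ l, a l ^ 2 ≤ 1) (hb : ∑ l, b l ^ 2 ≤ 1) :
    ∑ c, (∑ l ∈ univ.filter (fun l => bin l = c), (a l ^ 2 - b l ^ 2)) ^ 2
      ≤ 4 * ∑ l, (a l - b l) ^ 2 := by
  have h := pool_perturb_sq bin a b
  have hsum : ∑ l, (a l + b l) ^ 2 ≤ 4 := by
    have h2 : ∀ l, (a l + b l) ^ 2 ≤ 2 * a l ^ 2 + 2 * b l ^ 2 := by
      intro l
      nlinarith [sq_nonneg (a l - b l)]
    calc ∑ l, (a l + b l) ^ 2 ≤ ∑ l, (2 * a l ^ 2 + 2 * b l ^ 2) :=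
          Finset.sum_le_sum fun l _ => h2 l
      _ = 2 * ∑ l, a l ^ 2 + 2 * ∑ l, b l ^ 2 := by
          rw [Finset.sum_add_distrib, Finset.mul_sum, Finset.mul_sum]
      _ ≤ 4 := by linarith
  have hnn : 0 ≤ ∑ l, (a l - b l) ^ 2 := Finset.sum_nonneg fun l _ => sq_nonneg _
  calc _ ≤ (∑ l, (a l - b l) ^ 2) * ∑ l, (a l + b l) ^ 2 := h
    _ ≤ (∑ l, (a l - b l) ^ 2) * 4 := mul_le_mul_of_nonneg_left hsum hnn
    _ = 4 * ∑ l, (a l - b l) ^ 2 := by ring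

/-- `[folklore]` Lipschitz estimate for the entrywise square (`g(ψ) = ψ∘ψ` in arXiv:2510.07195
Lemma C.2): if `(u_l + x_l)² ≤ M` for all `l` then `Σ_l (u_l² − x_l²)² ≤ M Σ_l (u_l − x_l)²`. -/
theorem sq_sub_sq_sum_le (u x : ι → ℝ) (M : ℝ) (hM : ∀ l, (u l + x l) ^ 2 ≤ M) :
    ∑ l, (u l ^ 2 - x l ^ 2) ^ 2 ≤ M * ∑ l, (u l - x l) ^ 2 := by
  rw [Finset.mul_sum]
  refine Finset.sum_le_sum fun l _ => ?_
  have hfac : (u l ^ 2 - x l ^ 2) ^ 2 = (u l + x l) ^ 2 * (u l - x l) ^ 2 := by ring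
  rw [hfac]
  exact mul_le_mul_of_nonneg_right (hM l) (sq_nonneg _)

end Pooling

section Dense

variable {ι : Type*}

/-- `[folklore]` **Frobenius-free domination of a dense layer on a squared unit vector**
(DEQ-A74 Lemma D).  For nonnegative weights `p_j` with `Σ p_j = 1` and arbitrary reals `w_j`,
`(Σ_j p_j w_j)² ≤ Σ_j p_j w_j²`.  With `p = ψ∘ψ` (`‖ψ‖₂ = 1`) and `w_j = W_{lj}` this reads
`(W(ψ∘ψ))_l² ≤ Σ_j ψ_j² W_{lj}²`, so the law "`j ∼ ψ²`, then `l ∼ W_{lj}²/‖W_{·j}‖²`" dominates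
`(W(ψ∘ψ))²` entrywise with importance weight `≤ max_j ‖W_{·j}‖² ≤ ‖W‖₂²` — independent of the
rank, sparsity and Frobenius norm of `W` (contrast arXiv:2510.07195 App. E.1). -/
theorem mean_sq_le_mean_of_sq (s : Finset ι) (p w : ι → ℝ) (hp : ∀ j ∈ s, 0 ≤ p j)
    (hsum : ∑ j ∈ s, p j = 1) :
    (∑ j ∈ s, p j * w j) ^ 2 ≤ ∑ j ∈ s, p j * w j ^ 2 := by
  have h := Finset.sum_sq_le_sum_mul_sum_of_sq_le_mul s (r := fun j => p j * w j)
    (f := fun j => p j) (g := fun j => p j * w j ^ 2) hp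
    (fun j hj => mul_nonneg (hp j hj) (sq_nonneg _))
    (fun j _ => by nlinarith [sq_nonneg (p j * w j)])
  simpa [hsum] using h

/-- `[folklore]` The same domination with column-normalised sampling weights: if moreover
`w_j² ≤ ρ² q_j` (in DEQ-A74: `q_j = W_{lj}²/‖W_{·j}‖²`, `ρ = max_j ‖W_{·j}‖`), then
`(Σ_j p_j w_j)² ≤ ρ² Σ_j p_j q_j`: the rejection/importance weight of Algorithm RS's output block
is at most `ρ² ≤ 1`. -/
theorem mean_sq_le_of_col_bound (s : Finset ι) (p w q : ι → ℝ) (ρ : ℝ) (hp : ∀ j ∈ s, 0 ≤ p j)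
    (hsum : ∑ j ∈ s, p j = 1) (hq : ∀ j ∈ s, w j ^ 2 ≤ ρ ^ 2 * q j) :
    (∑ j ∈ s, p j * w j) ^ 2 ≤ ρ ^ 2 * ∑ j ∈ s, p j * q j := by
  have h1 := mean_sq_le_mean_of_sq s p w hp hsum
  have h2 : ∑ j ∈ s, p j * w j ^ 2 ≤ ∑ j ∈ s, p j * (ρ ^ 2 * q j) :=
    Finset.sum_le_sum fun j hj => mul_le_mul_of_nonneg_left (hq j hj) (hp j hj)
  have h3 : ∑ j ∈ s, p j * (ρ ^ 2 * q j) = ρ ^ 2 * ∑ j ∈ s, p j * q j := by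
    rw [Finset.mul_sum]
    refine Finset.sum_congr rfl fun j _ => ?_
    ring
  linarith [h3 ▸ h2]

end Dense

section Envelope

/-- `[folklore]` `g (x+e)² ≤ g (1+g) x² + (1+g) e²` for every real `g` (the difference is
`(g x − e)²`; for `g > 0` it reads `(x+e)² ≤ (1+g)x² + (1+1/g)e²`): the two-term Young split behind
the mixture proposal of Algorithm RS. -/
theorem mul_sq_add_le (x e g : ℝ) :
    g * (x + e) ^ 2 ≤ g * (1 + g) * x ^ 2 + (1 + g) * e ^ 2 := by
  nlinarith [sq_nonneg (g * x - e), sq_nonneg x, sq_nonneg e]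

/-- `[folklore]` **Rejection envelope of one residual sparse layer** (DEQ-A74 Lemma E).  With
`g > 0`, fan-out `s > 0`, the residual entry `x`, the activation value `e` and the receptive-field
mass `S` satisfying `s e² ≤ g² S` (from `|erf(0.8 t)| ≤ L|t|`, `|(Wx)_J| ≤ ρ √S_J` and `g = Lρ√s`),
the target `(x+e)²` is dominated: `s (x+e)² ≤ (1+g)(s x² + g S)`, equivalently
`(x+e)² ≤ (1+g)² · ( x²/(1+g) + (g/(1+g)) · S/s )` — acceptance probabilities are at most one and the
envelope constant is `(1+g)² = (1 + Lρ√s)²`. -/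
theorem residual_envelope (x e S g s : ℝ) (hg : 0 < g) (hs : 0 < s) (he : s * e ^ 2 ≤ g ^ 2 * S) :
    s * (x + e) ^ 2 ≤ (1 + g) * (s * x ^ 2 + g * S) := by
  have key : g * ((1 + g) * (s * x ^ 2 + g * S) - s * (x + e) ^ 2)
      = s * (g * x - e) ^ 2 + (1 + g) * (g ^ 2 * S - s * e ^ 2) := by ring
  have hnn : 0 ≤ g * ((1 + g) * (s * x ^ 2 + g * S) - s * (x + e) ^ 2) := by
    rw [key]
    have h1 : 0 ≤ s * (g * x - e) ^ 2 := mul_nonneg hs.le (sq_nonneg _)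
    have h2 : 0 ≤ (1 + g) * (g ^ 2 * S - s * e ^ 2) := mul_nonneg (by linarith) (by linarith)
    linarith
  have h3 : 0 ≤ (1 + g) * (s * x ^ 2 + g * S) - s * (x + e) ^ 2 :=
    (mul_nonneg_iff_of_pos_left hg).mp hnn
  linarith

/-- `[folklore]` Normalising two nonzero vectors costs at most a factor two:
`‖a/‖a‖ − b/‖b‖‖ ≤ 2‖a − b‖/‖a‖` (used for every normalisation layer and for `γ/‖γ‖` in DEQ-A74). -/
theorem norm_normalize_sub_normalize_le {E : Type*} [NormedAddCommGroup E] [NormedSpace ℝ E]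
    (a b : E) (ha : a ≠ 0) (hb : b ≠ 0) :
    ‖(‖a‖⁻¹ : ℝ) • a - (‖b‖⁻¹ : ℝ) • b‖ ≤ 2 * ‖a - b‖ / ‖a‖ := by
  have hna : 0 < ‖a‖ := norm_pos_iff.mpr ha
  have hnb : 0 < ‖b‖ := norm_pos_iff.mpr hb
  have hsplit : (‖a‖⁻¹ : ℝ) • a - (‖b‖⁻¹ : ℝ) • b
      = (‖a‖⁻¹ : ℝ) • (a - b) + ((‖a‖⁻¹ : ℝ) - ‖b‖⁻¹) • b := by
    rw [smul_sub, sub_smul]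
    abel
  have hdiff : ((‖a‖⁻¹ : ℝ) - ‖b‖⁻¹) = (‖b‖ - ‖a‖) / (‖a‖ * ‖b‖) := by
    field_simp
  calc ‖(‖a‖⁻¹ : ℝ) • a - (‖b‖⁻¹ : ℝ) • b‖
      = ‖(‖a‖⁻¹ : ℝ) • (a - b) + ((‖a‖⁻¹ : ℝ) - ‖b‖⁻¹) • b‖ := by rw [hsplit]
    _ ≤ ‖(‖a‖⁻¹ : ℝ) • (a - b)‖ + ‖((‖a‖⁻¹ : ℝ) - ‖b‖⁻¹) • b‖ := norm_add_le _ _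
    _ = ‖a‖⁻¹ * ‖a - b‖ + |‖b‖ - ‖a‖| / (‖a‖ * ‖b‖) * ‖b‖ := by
        rw [norm_smul, norm_smul, hdiff, Real.norm_eq_abs, Real.norm_eq_abs,
          abs_of_pos (inv_pos.mpr hna), abs_div, abs_of_pos (mul_pos hna hnb)]
    _ = (‖a - b‖ + |‖b‖ - ‖a‖|) / ‖a‖ := by
        field_simp
    _ ≤ (‖a - b‖ + ‖a - b‖) / ‖a‖ := by
        gcongr
        calc |‖b‖ - ‖a‖| = |‖a‖ - ‖b‖| := abs_sub_comm _ _
          _ ≤ ‖a - b‖ := abs_norm_sub_norm_le a b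
    _ = 2 * ‖a - b‖ / ‖a‖ := by ring

end Envelope

end Literature.Computability.QuantumAlgorithms.SquaredActivationSampling
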